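import Literature.NumberTheory.LFunctions.Zhang2022.DetectorShiftDoubledParseval

/-!
# Two-sided doubling, calculus half: reflection invariance and separated-support additivity of the bulk form,
# the PERIODIC two-piece Parseval inequality on the cell `[−1,1]`, and the arcs of the circle function

Y. Zhang, *Discrete mean estimates and the Landau–Siegel zero*, arXiv:2211.02515v1 [Zhang2022LandauSiegel] —
an unrefereed manuscript under adjudication. **WHAT THIS IS NOT: not a claim about Theorems 1–2 of
arXiv:2211.02515, about Landau–Siegel zeros, about a repaired `Margin232`, or about Parity; nothing here asserts
E-102, the E-010 slot or any registry row. The programme SEARCHES and TYPES; no claim about Landau–Siegel zeros,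
Theorems 1–2 of arXiv:2211.02515 or a repaired Margin232 until a kernel theorem says so.**

CONTEXT (cell landau-siegel §E; ls-barrier-num g3 `barrier/num/TWO-SIDED-CIRCLE.md` §5 items K3″/K6″; ls-num-2 g4
Id-5). The two-sided glued form of a shift triple is, after [K1], `c₀ × (bulk form of ONE function on the circle
ℝ/2ℤ)`; this file supplies the calculus the composition [K6″] (`DetectorTwoSidedCompose`) needs, all about the
tree's bulk form `Det.bulkFormOn b a c S S′ S″` (`DetectorShiftClosedForm`, ls-barrier-p2 g3):

* Part 1: `bulkFormOn_reflect_conj` — invariance under the conjugate reflection `S ↦ −conj S(1−·)` (side 2 enters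
  the glued profile reflected, §12 (12.6)–(12.8)); `intervalIntegrable_bulkDensity`; `bulkFormOn_add_of_separated`
  — additivity over two triples with separated supports (no overlap `t₁ + t₂ ≤ 1`).
* Part 2: **`bulkFormOn_periodic_two_piece_nonneg_of_signAdmissible`** — pieces `L` on `[−1,0]`, `R` on `[0,1]`
  with `C¹` matching at `0` AND periodic `C¹` matching `L(−1) = R(1)`, `L′(−1) = R′(1)` (no clamps), second
  right-derivative of `R` allowed to fail on a finite node set: `0 ≤ T_b^{[−1,0]}(L) + T_b^{[0,1]}(R)` for
  sign-admissible `b` — [K3′] `Det.bulkFormOn_circle_nonneg_of_signAdmissible` (ls-Bmulti-typer-2 g3, p488397)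
  applied to the glued function on the cell `[−1,1]`, then `Det.bulkFormOn_add_adjacent`. (Two-sided twin of
  `Det.bulkFormOn_two_piece_nonneg_of_signAdmissible`, which has clamps at `±1`.)
* Part 3: the arcs — transport along `y ↦ y+1` (as in [K6]), `hasDerivAt_tailPrim`, `tailPrim_eq_zero_of_support`,
  and **`reflArc_of_kinked`**: the conjugate-reflected arc `−conj (tailPrim g)(1−·)` of a one-sided kinked profile
  differentiable off a finite node set satisfies the right-piece hypotheses (continuity, right-derivatives, `L²`).

0 named facts, 0 `def`s, 0 sorries; elementary real analysis; standard axioms. Cell landau-siegel, ls-barrier-p5 g4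
(CLAIM 2026-08-27T03:08:50Z). References: Y. Zhang, arXiv:2211.02515v1 (2022), Prop. 7.1 p.44 with (7.2),
(8.11)–(8.23), §12 (12.6)–(12.8); Y. Katznelson, *An introduction to harmonic analysis* (2004) Ch. I §5
[Katznelson2004]; barrier/num/TWO-SIDED-CIRCLE.md (ls-barrier-num, cell-internal).
[cite: Zhang2022LandauSiegel, Prop 7.1 p.44 with (7.2), (8.11)–(8.23)]
-/

noncomputable section

open Complex Real Set intervalIntegral Filter Topology
open _root_.MeasureTheory
open scoped ComplexConjugate

namespace Literature.NumberTheory.LFunctions.Zhang2022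

namespace Det

open Repair

variable {b : Fin 3 → ℝ}

/-! ### Part 1 — reflection invariance and separated-support additivity of the bulk form -/

/-- **Reflection invariance of the bulk form**: for the conjugate reflection `G = −conj S(1−·)` (so
`G′ = conj S′(1−·)`, `G″ = −conj S″(1−·)`), `T_b^{[0,1]}(G) = T_b^{[0,1]}(S)` — the four densities are invariant
(`|·|²` twice; `Im(−conj z) = Im z` for the two `Im` terms) and `∫₀¹ φ(1−y) dy = ∫₀¹ φ`.
[cite: Zhang2022LandauSiegel, Prop 7.1 p.44 with (8.11)–(8.23); §12 (12.6)–(12.8)] -/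
theorem bulkFormOn_reflect_conj (b : Fin 3 → ℝ) (S S' S'' : ℝ → ℂ) :
    bulkFormOn b 0 1 (fun y => -conj (S (1 - y))) (fun y => conj (S' (1 - y))) (fun y => -conj (S'' (1 - y)))
      = bulkFormOn b 0 1 S S' S'' := by
  unfold bulkFormOn
  have hφ : ∀ y : ℝ,
      ‖-conj (S'' (1 - y))‖ ^ 2 + π * (b 0 + b 1 + b 2) * (-conj (S'' (1 - y)) * conj (conj (S' (1 - y)))).im
        + π ^ 2 * (b 0 * b 1 + b 1 * b 2 + b 2 * b 0) * ‖conj (S' (1 - y))‖ ^ 2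
        + π ^ 3 * (b 0 * b 1 * b 2) * (conj (S' (1 - y)) * conj (-conj (S (1 - y)))).im
      = (fun x => ‖S'' x‖ ^ 2 + π * (b 0 + b 1 + b 2) * (S'' x * conj (S' x)).im
        + π ^ 2 * (b 0 * b 1 + b 1 * b 2 + b 2 * b 0) * ‖S' x‖ ^ 2
        + π ^ 3 * (b 0 * b 1 * b 2) * (S' x * conj (S x)).im) (1 - y) := by
    intro y
    simp only [norm_neg, Complex.norm_conj, Complex.conj_conj, map_neg, neg_mul, mul_neg, Complex.neg_im]
    have e1 : (conj (S'' (1 - y)) * S' (1 - y)).im = -(S'' (1 - y) * conj (S' (1 - y))).im := by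
      rw [← Complex.conj_conj (S' (1 - y)), ← map_mul, Complex.conj_im, Complex.conj_conj]
    have e2 : (conj (S' (1 - y)) * S (1 - y)).im = -(S' (1 - y) * conj (S (1 - y))).im := by
      rw [← Complex.conj_conj (S (1 - y)), ← map_mul, Complex.conj_im, Complex.conj_conj]
    rw [e1, e2]
    ring
  simp_rw [hφ]
  rw [intervalIntegral.integral_comp_sub_left (fun x => ‖S'' x‖ ^ 2 + π * (b 0 + b 1 + b 2) * (S'' x * conj (S' x)).im
        + π ^ 2 * (b 0 * b 1 + b 1 * b 2 + b 2 * b 0) * ‖S' x‖ ^ 2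
        + π ^ 3 * (b 0 * b 1 * b 2) * (S' x * conj (S x)).im) 1]
  norm_num

/-- The density of the bulk form is interval integrable for continuous `S, S′` and square-integrable `S″`.
[cite: Zhang2022LandauSiegel, Prop 7.1 p.44 with (8.11)–(8.23)] -/
theorem intervalIntegrable_bulkDensity (b : Fin 3 → ℝ) {a c : ℝ} (hac : a ≤ c) {S S' S'' : ℝ → ℂ}
    (hS : ContinuousOn S (Icc a c)) (hS' : ContinuousOn S' (Icc a c))
    (hS''m : MemLp S'' 2 (volume.restrict (Ioc a c))) :
    IntervalIntegrable (fun y => ‖S'' y‖ ^ 2 + π * (b 0 + b 1 + b 2) * (S'' y * conj (S' y)).im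
        + π ^ 2 * (b 0 * b 1 + b 1 * b 2 + b 2 * b 0) * ‖S' y‖ ^ 2
        + π ^ 3 * (b 0 * b 1 * b 2) * (S' y * conj (S y)).im) volume a c := by
  have iB : IntervalIntegrable (fun y => conj (S' y) * S'' y) volume a c :=
    intervalIntegrable_conj_mul_of_continuousOn_of_memLp' hac hS' hS''m
  have rA : IntervalIntegrable (fun y => ‖S'' y‖ ^ 2) volume a c := by
    rw [intervalIntegrable_iff_integrableOn_Ioc_of_le hac]
    exact (memLp_two_iff_integrable_sq_norm hS''m.1).1 hS''m
  have rB : IntervalIntegrable (fun y => π * (b 0 + b 1 + b 2) * (S'' y * conj (S' y)).im) volume a c := by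
    have h1 : IntervalIntegrable (fun y => (conj (S' y) * S'' y).im) volume a c := by
      rw [intervalIntegrable_iff_integrableOn_Ioc_of_le hac] at iB ⊢
      exact iB.im
    exact (h1.congr fun y _ => by simp only [mul_comm]).const_mul _
  have rC : IntervalIntegrable (fun y => π ^ 2 * (b 0 * b 1 + b 1 * b 2 + b 2 * b 0) * ‖S' y‖ ^ 2) volume a c := by
    have : ContinuousOn (fun y => ‖S' y‖ ^ 2) (Icc a c) := (hS'.norm).pow 2
    exact (this.intervalIntegrable_of_Icc hac).const_mul _
  have rD : IntervalIntegrable (fun y => π ^ 3 * (b 0 * b 1 * b 2) * (S' y * conj (S y)).im) volume a c := by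
    have : ContinuousOn (fun y => (S' y * conj (S y)).im) (Icc a c) :=
      Complex.continuous_im.comp_continuousOn (hS'.mul (Complex.continuous_conj.comp_continuousOn hS))
    exact (this.intervalIntegrable_of_Icc hac).const_mul _
  exact ((rA.add rB).add rC).add rD

/-- **Separated supports add**: if on `[0,1]` the triple `(S₁,S₁′,S₁″)` vanishes on `[t,1]` and `(S₂,S₂′,S₂″)`
vanishes on `[0,t]`, then `T_b^{[0,1]}(S₁+S₂) = T_b^{[0,1]}(S₁) + T_b^{[0,1]}(S₂)` (the density is a quadratic
form evaluated where at most one of the two triples is non-zero). [cite: Zhang2022LandauSiegel, Prop 7.1 p.44 with (8.11)–(8.23); §8 (8.2)] -/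
theorem bulkFormOn_add_of_separated (b : Fin 3 → ℝ) {S₁ S₁' S₁'' S₂ S₂' S₂'' : ℝ → ℂ} (t : ℝ)
    (hz₁ : ∀ y ∈ Icc (0:ℝ) 1, t ≤ y → S₁ y = 0 ∧ S₁' y = 0 ∧ S₁'' y = 0)
    (hz₂ : ∀ y ∈ Icc (0:ℝ) 1, y ≤ t → S₂ y = 0 ∧ S₂' y = 0 ∧ S₂'' y = 0)
    (hS₁ : ContinuousOn S₁ (Icc 0 1)) (hS₁' : ContinuousOn S₁' (Icc 0 1))
    (hS₁'' : MemLp S₁'' 2 (volume.restrict (Ioc (0:ℝ) 1)))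
    (hS₂ : ContinuousOn S₂ (Icc 0 1)) (hS₂' : ContinuousOn S₂' (Icc 0 1))
    (hS₂'' : MemLp S₂'' 2 (volume.restrict (Ioc (0:ℝ) 1))) :
    bulkFormOn b 0 1 (fun y => S₁ y + S₂ y) (fun y => S₁' y + S₂' y) (fun y => S₁'' y + S₂'' y)
      = bulkFormOn b 0 1 S₁ S₁' S₁'' + bulkFormOn b 0 1 S₂ S₂' S₂'' := by
  have i₁ := intervalIntegrable_bulkDensity b zero_le_one hS₁ hS₁' hS₁''
  have i₂ := intervalIntegrable_bulkDensity b zero_le_one hS₂ hS₂' hS₂''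
  unfold bulkFormOn
  rw [← intervalIntegral.integral_add i₁ i₂]
  refine intervalIntegral.integral_congr fun y hy => ?_
  rw [uIcc_of_le zero_le_one] at hy
  rcases le_or_gt t y with hty | hty
  · obtain ⟨e0, e1, e2⟩ := hz₁ y hy hty
    simp only [e0, e1, e2, zero_add, norm_zero, mul_zero, map_zero, Complex.zero_im, add_zero]
    ring
  · obtain ⟨e0, e1, e2⟩ := hz₂ y hy hty.le
    simp only [e0, e1, e2, add_zero, norm_zero, mul_zero, map_zero, Complex.zero_im]
    ring

/-! ### Part 2 — two pieces glued into ONE periodic function on the cell `[−1,1]`, and [K3′] -/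

section Circle

variable {L L' L'' R R' R'' : ℝ → ℂ}

/-- Continuity of a glued function on the cell from continuity of the pieces and matching at `0`. [folklore] -/
private theorem continuousOn_glue_cell (hLc : ContinuousOn L (Icc (-1:ℝ) 0)) (hRc : ContinuousOn R (Icc (0:ℝ) 1))
    (hm : L 0 = R 0) : ContinuousOn (glue L R) (Icc (-1:ℝ) 1) := by
  unfold glue
  refine ContinuousOn.piecewise ?_ ?_ ?_
  · rintro a ⟨-, ha⟩
    rw [frontier_Iic, mem_singleton_iff] at ha
    rw [ha]; exact hm
  · rw [closure_Iic]
    exact hLc.mono fun y hy => ⟨hy.1.1, hy.2⟩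
  · rw [compl_Iic, closure_Ioi]
    exact hRc.mono fun y hy => ⟨hy.2, hy.1.2⟩

/-- Right-derivatives of a glued function at the interior points of the left piece. [folklore] -/
private theorem hasDerivWithinAt_glue_left {f f' g g' : ℝ → ℂ} {y : ℝ} (hy : y < 0)
    (h : HasDerivWithinAt f (f' y) (Ioi y) y) : HasDerivWithinAt (glue f g) (glue f' g' y) (Ioi y) y := by
  rw [glue_of_le hy.le]
  refine h.congr_of_eventuallyEq ?_ (glue_of_le hy.le)
  exact Filter.eventuallyEq_of_mem (Ioo_mem_nhdsGT hy) fun z hz => glue_of_le hz.2.le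

/-- Right-derivatives of a glued function at the interior points of the right piece. [folklore] -/
private theorem hasDerivWithinAt_glue_right {f f' g g' : ℝ → ℂ} {y : ℝ} (hy : 0 < y)
    (h : HasDerivWithinAt g (g' y) (Ioi y) y) : HasDerivWithinAt (glue f g) (glue f' g' y) (Ioi y) y := by
  rw [glue_of_pos hy]
  refine h.congr_of_eventuallyEq ?_ (glue_of_pos hy)
  exact Filter.eventuallyEq_of_mem self_mem_nhdsWithin fun z hz => glue_of_pos (hy.trans hz)

/-- **The periodic two-piece bulk form is `≥ 0` for a sign-admissible triple.** Pieces `L` on `[−1,0]` and `R` on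
`[0,1]`, each continuous with continuous first derivative, right-derivatives `L → L′ → L″` on `(−1,0)` and
`R → R′ → R″` on `(0,1)` (the second one outside a finite node set `N`), `L″, R″ ∈ L²`, `C¹` MATCHING at `0`
(`L(0) = R(0)`, `L′(0) = R′(0)`) and PERIODIC `C¹` matching (`L(−1) = R(1)`, `L′(−1) = R′(1)`) — no clamps:
`0 ≤ T_b^{[−1,0]}(L) + T_b^{[0,1]}(R)`. ([K3′] `Det.bulkFormOn_circle_nonneg_of_signAdmissible` for the glued
function on the cell `[−1,1]` with nodes `N ∪ {0}`, then `Det.bulkFormOn_add_adjacent`.) This is the two-sided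
twin of `Det.bulkFormOn_two_piece_nonneg_of_signAdmissible` (clamps at `±1` there).
[cite: Zhang2022LandauSiegel, Prop 7.1 p.44 with (7.2), (8.11)–(8.23)] -/
theorem bulkFormOn_periodic_two_piece_nonneg_of_signAdmissible (hb : SignAdmissible b) (N : Finset ℝ)
    (hLc : ContinuousOn L (Icc (-1:ℝ) 0)) (hL'c : ContinuousOn L' (Icc (-1:ℝ) 0))
    (hL''m : MemLp L'' 2 (volume.restrict (Ioc (-1:ℝ) 0)))
    (hLd : ∀ y ∈ Ioo (-1:ℝ) 0, HasDerivWithinAt L (L' y) (Ioi y) y)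
    (hL'd : ∀ y ∈ Ioo (-1:ℝ) 0, HasDerivWithinAt L' (L'' y) (Ioi y) y)
    (hRc : ContinuousOn R (Icc (0:ℝ) 1)) (hR'c : ContinuousOn R' (Icc (0:ℝ) 1))
    (hR''m : MemLp R'' 2 (volume.restrict (Ioc (0:ℝ) 1)))
    (hRd : ∀ y ∈ Ioo (0:ℝ) 1, HasDerivWithinAt R (R' y) (Ioi y) y)
    (hR'd : ∀ y ∈ Ioo (0:ℝ) 1, y ∉ N → HasDerivWithinAt R' (R'' y) (Ioi y) y)
    (hm0 : L 0 = R 0) (hm1 : L' 0 = R' 0) (hp0 : L (-1) = R 1) (hp1 : L' (-1) = R' 1) :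
    0 ≤ bulkFormOn b (-1) 0 L L' L'' + bulkFormOn b 0 1 R R' R'' := by
  classical
  -- the glued function on the cell and its data
  have hFc : ContinuousOn (glue L R) (Icc (-1:ℝ) 1) := continuousOn_glue_cell hLc hRc hm0
  have hF'c : ContinuousOn (glue L' R') (Icc (-1:ℝ) 1) := continuousOn_glue_cell hL'c hR'c hm1
  have hF''m : MemLp (glue L'' R'') 2 (volume.restrict (Ioc (-1:ℝ) 1)) := memLp_glue hL''m hR''m
  have hFd : ∀ y ∈ Ioo (-1:ℝ) 1, y ∉ insert (0:ℝ) N →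
      HasDerivWithinAt (glue L R) (glue L' R' y) (Ioi y) y := by
    intro y hy hyN
    have hy0 : y ≠ 0 := fun h => hyN (h ▸ Finset.mem_insert_self _ _)
    rcases lt_or_gt_of_ne hy0 with h | h
    · exact hasDerivWithinAt_glue_left h (hLd y ⟨hy.1, h⟩)
    · exact hasDerivWithinAt_glue_right h (hRd y ⟨h, hy.2⟩)
  have hF'd : ∀ y ∈ Ioo (-1:ℝ) 1, y ∉ insert (0:ℝ) N →
      HasDerivWithinAt (glue L' R') (glue L'' R'' y) (Ioi y) y := by
    intro y hy hyN
    have hy0 : y ≠ 0 := fun h => hyN (h ▸ Finset.mem_insert_self _ _)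
    have hyN' : y ∉ N := fun h => hyN (Finset.mem_insert_of_mem h)
    rcases lt_or_gt_of_ne hy0 with h | h
    · exact hasDerivWithinAt_glue_left h (hL'd y ⟨hy.1, h⟩)
    · exact hasDerivWithinAt_glue_right h (hR'd y ⟨h, hy.2⟩ hyN')
  have hper0 : glue L R (-1) = glue L R 1 := by
    rw [glue_of_le (by norm_num), glue_of_pos one_pos, hp0]
  have hper1 : glue L' R' (-1) = glue L' R' 1 := by
    rw [glue_of_le (by norm_num), glue_of_pos one_pos, hp1]
  -- [K3′] on the cell `[−1, 1]`
  have key : 0 ≤ bulkFormOn b (-1) 1 (glue L R) (glue L' R') (glue L'' R'') := by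
    have h := bulkFormOn_circle_nonneg_of_signAdmissible (S := glue L R) (S' := glue L' R') (S'' := glue L'' R'')
      hb (-1) (insert (0:ℝ) N)
    simp only [show (-1:ℝ) + 2 = 1 by norm_num] at h
    exact h hFc hF'c hFd hF'd hF''m hper0 hper1
  -- split at `0` and read off the pieces
  rw [bulkFormOn_add_adjacent b (x := 0) ⟨by norm_num, by norm_num⟩ hFc hF'c hF''m] at key
  have hleft : bulkFormOn b (-1) 0 (glue L R) (glue L' R') (glue L'' R'') = bulkFormOn b (-1) 0 L L' L'' := by
    unfold bulkFormOn
    refine intervalIntegral.integral_congr fun y hy => ?_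
    rw [uIcc_of_le (by norm_num)] at hy
    simp only [glue_of_le hy.2]
  have hright : bulkFormOn b 0 1 (glue L R) (glue L' R') (glue L'' R'') = bulkFormOn b 0 1 R R' R'' := by
    unfold bulkFormOn
    refine intervalIntegral.integral_congr_ae (ae_of_all _ fun y hy => ?_)
    rw [uIoc_of_le zero_le_one] at hy
    simp only [glue_of_pos hy.1]
  rwa [hleft, hright] at key

end Circle

/-! ### Part 3 — the arcs of the circle function: the translated two-point piece, side 1, reflected side 2 -/

section Arcs

variable {g g' : ℝ → ℂ}

/-- Continuity transported along `y ↦ y + 1` (as in [K6]). [folklore] -/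
private theorem continuousOn_comp_add_one' {F : ℝ → ℂ} (hF : ContinuousOn F (Icc 0 1)) :
    ContinuousOn (fun y => F (y + 1)) (Icc (-1) 0) := by
  refine hF.comp (continuous_id.add continuous_const).continuousOn fun y hy => ?_
  exact ⟨by linarith [hy.1], by linarith [hy.2]⟩

/-- Right-derivatives transported along `y ↦ y + 1` (as in [K6]). [folklore] -/
private theorem hasDerivWithinAt_comp_add_one' {F F' : ℝ → ℂ}
    (hF : ∀ y ∈ Ioo (0:ℝ) 1, HasDerivWithinAt F (F' y) (Ioi y) y) {y : ℝ} (hy : y ∈ Ioo (-1:ℝ) 0) :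
    HasDerivWithinAt (fun y => F (y + 1)) (F' (y + 1)) (Ioi y) y := by
  have hy' : y + 1 ∈ Ioo (0:ℝ) 1 := ⟨by linarith [hy.1], by linarith [hy.2]⟩
  have h := hF (y + 1) hy'
  have h2 : HasDerivWithinAt (fun t : ℝ => t + 1) (1:ℝ) (Ioi y) y := (hasDerivAt_id y).add_const 1 |>.hasDerivWithinAt
  have := h.scomp y h2 (fun t ht => by simpa using ht)
  rw [Function.comp_def] at this
  simpa using this

/-- The map `y ↦ 1 − y` preserves Lebesgue measure restricted to `(0,1]` (as in `RepairGluedForm`). [folklore] -/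
private theorem measurePreserving_one_sub_Ioc' :
    MeasurePreserving (fun y : ℝ => 1 - y) (volume.restrict (Ioc (0:ℝ) 1)) (volume.restrict (Ioc (0:ℝ) 1)) := by
  have h := (Measure.measurePreserving_sub_left (volume : Measure ℝ) (1:ℝ)).restrict_preimage
    (measurableSet_Ioc (a := (0:ℝ)) (b := 1))
  have hpre : (fun y : ℝ => 1 - y) ⁻¹' Ioc (0:ℝ) 1 = Ico 0 1 := by
    ext y
    simp only [mem_preimage, mem_Ioc, mem_Ico]
    constructor <;> rintro ⟨h1, h2⟩ <;> constructor <;> linarith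
  rw [hpre, restrict_Ico_eq_restrict_Ioc] at h
  exact h

/-- The tail primitive `y ↦ ∫_y^1 g` has (two-sided) derivative `−g(x)` at interior points, `g` continuous on
`[0,1]`. [cite: Zhang2022LandauSiegel, Prop 7.1 p.44 with (8.11)–(8.12)] -/
theorem hasDerivAt_tailPrim (hg : ContinuousOn g (Icc 0 1)) {x : ℝ} (hx : x ∈ Ioo (0:ℝ) 1) :
    HasDerivAt (tailPrim g) (-g x) x := by
  have hint : IntervalIntegrable g volume x 1 :=
    (hg.mono (Icc_subset_Icc hx.1.le le_rfl)).intervalIntegrable_of_Icc hx.2.le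
  have hmeas : StronglyMeasurableAtFilter g (nhds x) volume :=
    ContinuousOn.stronglyMeasurableAtFilter isOpen_Ioo (hg.mono Ioo_subset_Icc_self) x hx
  have hcont : ContinuousAt g x := hg.continuousAt (Icc_mem_nhds hx.1 hx.2)
  exact intervalIntegral.integral_hasDerivAt_left hint hmeas hcont

/-- A one-sided profile supported in `[0,t]`: its tail primitive vanishes on `[t,1]`.
[cite: Zhang2022LandauSiegel, Prop 7.1 p.44 with (8.11)–(8.12)] -/
theorem tailPrim_eq_zero_of_support {t : ℝ} (hz : ∀ y ∈ Icc t 1, g y = 0) {y : ℝ} (hy : y ∈ Icc (0:ℝ) 1)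
    (hty : t ≤ y) : tailPrim g y = 0 := by
  have : ∫ s in y..(1:ℝ), g s = ∫ s in y..(1:ℝ), (0:ℂ) := intervalIntegral.integral_congr fun s hs => by
    rw [uIcc_of_le hy.2] at hs
    exact hz s ⟨hty.trans hs.1, hs.2⟩
  rw [tailPrim, this, intervalIntegral.integral_zero]

/-- **The conjugate-reflected side-2 arc** `G = −conj S(1−·)`, `S = tailPrim g`, of a one-sided kinked profile `g`
that is (two-sided) differentiable outside a finite node set `N`: continuity of `G, G′` on `[0,1]`,
right-derivatives `G → G′` on `(0,1)` and `G′ → G″` off the reflected nodes, `G″ ∈ L²`.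
[cite: Zhang2022LandauSiegel, Prop 7.1 p.44 with (8.11)–(8.23); §12 (12.6)–(12.8)] -/
theorem reflArc_of_kinked (hg : KinkedProfile g g') (hg1 : g 1 = 0) (N : Finset ℝ)
    (hN : ∀ x ∈ Ioo (0:ℝ) 1, x ∉ N → HasDerivAt g (g' x) x) :
    ContinuousOn (fun y => -conj (tailPrim g (1 - y))) (Icc (0:ℝ) 1)
    ∧ ContinuousOn (fun y => conj (-g (1 - y))) (Icc (0:ℝ) 1)
    ∧ (∀ y ∈ Ioo (0:ℝ) 1,
        HasDerivWithinAt (fun y => -conj (tailPrim g (1 - y))) (conj (-g (1 - y))) (Ioi y) y)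
    ∧ (∀ y ∈ Ioo (0:ℝ) 1, (1 - y) ∉ N →
        HasDerivWithinAt (fun y => conj (-g (1 - y))) (-conj (-g' (1 - y))) (Ioi y) y)
    ∧ MemLp (fun y => -conj (-g' (1 - y))) 2 (volume.restrict (Ioc (0:ℝ) 1)) := by
  obtain ⟨hTc, -, -, -, -, -, -⟩ := rightPiece_of_kinked hg hg1
  have hmaps : MapsTo (fun y : ℝ => 1 - y) (Icc (0:ℝ) 1) (Icc (0:ℝ) 1) := fun y hy =>
    ⟨by linarith [hy.2], by linarith [hy.1]⟩
  have hsub : ContinuousOn (fun y : ℝ => 1 - y) (Icc (0:ℝ) 1) := (continuous_const.sub continuous_id).continuousOn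
  have c1 : ContinuousOn (fun y => tailPrim g (1 - y)) (Icc (0:ℝ) 1) := hTc.comp hsub hmaps
  have c2 : ContinuousOn (fun y => g (1 - y)) (Icc (0:ℝ) 1) := hg.cont.comp hsub hmaps
  refine ⟨(Complex.continuous_conj.comp_continuousOn c1).neg, ?_, ?_, ?_, ?_⟩
  · exact Complex.continuous_conj.comp_continuousOn c2.neg
  · intro y hy
    have hx : 1 - y ∈ Ioo (0:ℝ) 1 := ⟨by linarith [hy.2], by linarith [hy.1]⟩
    have hT := hasDerivAt_tailPrim hg.cont hx
    have h1m : HasDerivAt (fun y : ℝ => 1 - y) (-1) y := by simpa using (hasDerivAt_id y).const_sub 1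
    have hc := ((hT.scomp y h1m).star).neg
    refine (hc.congr_deriv ?_).hasDerivWithinAt
    simp only [neg_smul, one_smul, neg_neg]
    rfl
  · intro y hy hyN
    have hx : 1 - y ∈ Ioo (0:ℝ) 1 := ⟨by linarith [hy.2], by linarith [hy.1]⟩
    have hd := hN (1 - y) hx hyN
    have h1m : HasDerivAt (fun y : ℝ => 1 - y) (-1) y := by simpa using (hasDerivAt_id y).const_sub 1
    have hc := ((hd.scomp y h1m).neg).star
    refine (hc.congr_deriv ?_).hasDerivWithinAt
    simp only [neg_smul, one_smul, neg_neg, map_neg]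
    rfl
  · have h1 : MemLp (g' ∘ fun y : ℝ => 1 - y) 2 (volume.restrict (Ioc (0:ℝ) 1)) :=
      hg.memLp.comp_measurePreserving measurePreserving_one_sub_Ioc'
    have h2 : MemLp (fun y => conj (g' (1 - y))) 2 (volume.restrict (Ioc (0:ℝ) 1)) :=
      (Complex.conjCLE.toContinuousLinearMap).comp_memLp' h1
    have : (fun y => -conj (-g' (1 - y))) = fun y => conj (g' (1 - y)) := by
      funext y; simp only [map_neg, neg_neg]
    rw [this]; exact h2

end Arcs


end Det

end Literature.NumberTheory.LFunctions.Zhang2022
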